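import Literature.MathematicalPhysics.QuantumManyBody.BosonicFloor
import Literature.MathematicalPhysics.QuantumManyBody.BoseGasDirichletMonotonicity
import Summits.AtomisticToContinuum.BoseEinsteinCondensation.Theorems.BECCellInformationOneBodyEntropyBoundDirichletFloor
import HarnessLib

/-!
# Crux `GroundStateRigidity` (stmt-AtomisticToContinuum-9072), line `Sketch`:
# the registered stub `stub_absoluteFloor` (ABS)

Supports (does not close) stmt-AtomisticToContinuum-9072; stub `stub_absoluteFloor` (ABS) of the
lines `loose_pricing` / `zoo_reduction` (skeleton v9). **The bosonic Dirichlet ground-state energy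
is the absolute one.** For a measurable pair potential `v ≥ 0` (hard cores allowed) and EVERY `C¹`
function `f` vanishing off the open box `Λ_L^N` — with no permutation symmetry and no
normalisation — `E₀(N, L) · ∫ |f|² ≤ ∫ (|∇f|² + ∑_{i<j} v(|xᵢ - xⱼ|) |f|²)`, where
`E₀(N, L) = groundStateEnergy v N L` is the infimum over Bose-SYMMETRIC normalised `C¹` Dirichlet
trial states [LSSY2005, Ch. 2, remark after (2.1): "the bosonic ground-state energy is the
absolute ground-state energy"].

## Proof

This is, up to the order of the binders, the statement already landed for the crux
`OneBodyEntropyBound` of route `BECCellInformation` (same problem):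
`Summit.AtomisticToContinuum.BoseEinsteinCondensation.Cruxes.OneBodyEntropyBound.Birth.DirichletFloor.groundStateEnergy_mul_lintegral_le`
(file `Theorems/BECCellInformationOneBodyEntropyBoundDirichletFloor.lean`), the Dirichlet port of
`Literature/MathematicalPhysics/QuantumManyBody/BosonicFloor.lean`: symmetrise the DENSITY,
`g_ε = √(ε² + ∑_σ |f ∘ (· ∘ σ)|²) − ε` is `C¹`, fully symmetric and vanishes off the box, so the
Dirichlet scaling inequality `groundStateEnergy_mul_normSq_le` gives `E₀ · ‖g_ε‖² ≤ 𝓔[g_ε]`;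
pointwise `|∇g_ε|² ≤ ∑_σ |∇f|² ∘ (· ∘ σ)` (convexity inequality for gradients
[LiebLoss2001, Thm. 7.8]) and `g_ε² ≤ ∑_σ |f ∘ σ|²`, the interaction and Lebesgue measure are
relabelling invariant, whence `𝓔[g_ε] ≤ N! · 𝓔[f]`; finally `‖g_{1/(n+1)}‖² → N! · ‖f‖²` by
dominated convergence and `N!` cancels. We import that file and re-export the result under the
registered name and signature; nothing is re-proved here.
-/

noncomputable section

open MeasureTheory Filter Metric
open scoped ENNReal NNReal Topology

namespace Summit.AtomisticToContinuum.BoseEinsteinCondensation.Theorems.GroundStateRigidity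

open Literature.MathematicalPhysics.QuantumManyBody.BoseGas

/-- **Stub `stub_absoluteFloor` (ABS) of lines `loose_pricing` / `zoo_reduction` — the bosonic
Dirichlet ground-state energy is the absolute one (Bose = Boltzmann for the infimum).** For
measurable `v ≥ 0` (hard cores allowed) and EVERY `C¹` function `f` vanishing off the open box
`Λ_L^N` — symmetric or not, normalised or not —
`E₀(N, L) · ∫ |f|² ≤ ∫ (|∇f|² + ∑_{i<j} v(|xᵢ - xⱼ|) |f|²)`. Proof: the symmetrised, regularised
modulus `g_ε = √(ε² + ∑_σ |f ∘ σ|²) − ε` is an admissible (unnormalised) bosonic Dirichlet trial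
function with `E₀ · ‖g_ε‖² ≤ N! · 𝓔[f]`, and `‖g_ε‖² → N! · ‖f‖²` as `ε = 1/(n+1) → 0`; cancel
`N!` — all of it landed as
`…Cruxes.OneBodyEntropyBound.Birth.DirichletFloor.groundStateEnergy_mul_lintegral_le`, which we
invoke. [cite: LSSY2005, Ch. 2 (bosons: remark after (2.1))] -/
theorem stub_absoluteFloor :
    ∀ (N : ℕ) (v : ℝ → ℝ≥0∞) (L : ℝ) (f : Config N → ℂ), Measurable v → ContDiff ℝ 1 f →
      (∀ X, X ∉ boxN N L → f X = 0) →
      groundStateEnergy v N L * ∫⁻ X, (‖f X‖₊ : ℝ≥0∞) ^ 2 ≤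
        ∫⁻ X, (kineticDensity f X + interaction v X * (‖f X‖₊ : ℝ≥0∞) ^ 2) :=
  fun _N _v _L _f hv hf h0 =>
    Cruxes.OneBodyEntropyBound.Birth.DirichletFloor.groundStateEnergy_mul_lintegral_le hv hf h0

end Summit.AtomisticToContinuum.BoseEinsteinCondensation.Theorems.GroundStateRigidity

end
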